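import Literature.AlgebraicGeometry.Smoothening.ConormalBaseChange
import Literature.AlgebraicGeometry.Smoothening.NeronDefect
import Mathlib.LinearAlgebra.TensorProduct.RightExactness
import Mathlib.LinearAlgebra.Dimension.RankNullity
import Mathlib.LinearAlgebra.Dimension.Localization
import Mathlib.LinearAlgebra.FreeModule.StrongRankCondition
import HarnessLib

/-!
# The fibre of the differentials of a quotient: `L ⊗_{S/J} Ω[(S/J)⁄R] = (L ⊗_S Ω[S⁄R]) / ⟨1 ⊗ df⟩`

Topic: `Literature/AlgebraicGeometry/Smoothening` (bookkeeping for Néron's measure for the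
defect of smoothness, BLR §3.3). For a surjection `S → S/J` of `R`-algebras and an
`S/J`-algebra `L` (in the application: `S = R[T₁, …, T_N]`, `X = Spec S/J ⊂ 𝔸ᴺ_R` and `L` a
discrete valuation ring through which an `L`-valued point `a` of `X` is given), the pulled-back
differentials `a*Ω¹_{X/R} = L ⊗_{S/J} Ω[(S/J)⁄R]` are the quotient of the free module
`L ⊗_S Ω[S⁄R] = ⊕ L dTᵢ` by the `L`-span of the `1 ⊗ df`, `f ∈ J` (the conormal sequence
`J/J² → (S/J) ⊗_S Ω[S⁄R] → Ω[(S/J)⁄R] → 0`, base-changed to `L`). PROVED here: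

* `conormalSpan R S J L` — the `L`-span of the `1 ⊗ df`, `f ∈ J`;
* `ker_map_baseChange_eq_conormalSpan` — **it is the kernel of
  `L ⊗_S Ω[S⁄R] → L ⊗_S Ω[(S/J)⁄R]`** (the latter `= L ⊗_{S/J} Ω[(S/J)⁄R]`,
  `tensorQuotientEquiv`), which is surjective (`map_baseChange_surjective`);
* `quotientConormalSpanEquiv` — the resulting isomorphism
  `(L ⊗_S Ω[S⁄R]) ⧸ conormalSpan ≃ L ⊗_{S/J} Ω[(S/J)⁄R]`;
* `neronDefect_quotient_eq` — hence `δ(a) = length (torsion ((L ⊗_S Ω[S⁄R]) ⧸ conormalSpan))`,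
  and `finrank_conormalSpan_add` — `rank conormalSpan + rank a*Ω¹_{X/R} = rank (L ⊗_S Ω[S⁄R])`
  (`L` a domain, modules finite).

The inclusion `ker ⊆ conormalSpan` is proved by descending the derivation
`s ↦ [1 ⊗ ds]` of `S` into the quotient module to `S/J` (it kills `J`, and `J` acts trivially),
which yields an `L`-linear retraction `L ⊗_{S/J} Ω[(S/J)⁄R] → (L ⊗_S Ω[S⁄R]) ⧸ conormalSpan` of
the natural map. [folklore]; no named facts (D-0026).

## References

* S. Bosch, W. Lütkebohmert, M. Raynaud, *Néron Models*, Springer 1990, §3.3.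
  [BLRNeronModels1990] (Not held; number only.)
* The statement is Mathlib's conormal sequence
  (`KaehlerDifferential.exact_kerCotangentToTensor_mapBaseChange`) after the base change
  `S/J → L`; a direct proof is given here.
-/

noncomputable section

open scoped TensorProduct
open Algebra KaehlerDifferential Submodule

namespace Literature.AlgebraicGeometry.Smoothening

universe u

variable (R : Type u) [CommRing R] (S : Type u) [CommRing S] [Algebra R S] (J : Ideal S)
  (L : Type u) [CommRing L] [Algebra R L] [Algebra S L] [IsScalarTower R S L]
  [Algebra (S ⧸ J) L] [IsScalarTower S (S ⧸ J) L] [IsScalarTower R (S ⧸ J) L]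

/-- **The conormal span**: the `L`-submodule of `L ⊗_S Ω[S⁄R]` spanned by the `1 ⊗ df`,
`f ∈ J`. [folklore] -/
def conormalSpan : Submodule L (L ⊗[S] Ω[S⁄R]) :=
  span L (Set.range fun f : J => (1 : L) ⊗ₜ[S] D R S (f : S))

omit [Algebra R L] [IsScalarTower R S L] [Algebra (S ⧸ J) L] [IsScalarTower S (S ⧸ J) L]
  [IsScalarTower R (S ⧸ J) L] in
/-- `1 ⊗ df ∈ conormalSpan` for `f ∈ J`. [folklore] -/
theorem tmul_D_mem_conormalSpan {f : S} (hf : f ∈ J) :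
    (1 : L) ⊗ₜ[S] D R S f ∈ conormalSpan R S J L :=
  subset_span ⟨⟨f, hf⟩, rfl⟩

omit [Algebra R L] [IsScalarTower R S L] [Algebra (S ⧸ J) L] [IsScalarTower S (S ⧸ J) L]
  [IsScalarTower R (S ⧸ J) L] in
/-- `l ⊗ df ∈ conormalSpan` for `f ∈ J`. [folklore] -/
theorem tmul_D_mem_conormalSpan' (l : L) {f : S} (hf : f ∈ J) :
    l ⊗ₜ[S] D R S f ∈ conormalSpan R S J L := by
  have : l ⊗ₜ[S] D R S f = l • ((1 : L) ⊗ₜ[S] D R S f) := by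
    rw [TensorProduct.smul_tmul', smul_eq_mul, mul_one]
  rw [this]
  exact smul_mem _ _ (tmul_D_mem_conormalSpan R S J L hf)

omit [Algebra R L] [IsScalarTower R S L] [Algebra (S ⧸ J) L] [IsScalarTower S (S ⧸ J) L]
  [IsScalarTower R (S ⧸ J) L] in
/-- The natural map `L ⊗_S Ω[S⁄R] → L ⊗_S Ω[(S/J)⁄R]` is surjective. [folklore] -/
theorem map_baseChange_surjective :
    Function.Surjective ((KaehlerDifferential.map R R S (S ⧸ J)).baseChange L) := by
  rw [LinearMap.baseChange_eq_ltensor]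
  exact LinearMap.lTensor_surjective L
    (KaehlerDifferential.map_surjective_of_surjective R R S (S ⧸ J) Ideal.Quotient.mk_surjective)

omit [Algebra R L] [IsScalarTower R S L] [Algebra (S ⧸ J) L] [IsScalarTower S (S ⧸ J) L]
  [IsScalarTower R (S ⧸ J) L] in
/-- `conormalSpan` is killed by `L ⊗_S Ω[S⁄R] → L ⊗_S Ω[(S/J)⁄R]` (`d f̄ = 0`). [folklore] -/
theorem conormalSpan_le_ker :
    conormalSpan R S J L ≤ LinearMap.ker ((KaehlerDifferential.map R R S (S ⧸ J)).baseChange L) := by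
  refine span_le.mpr ?_
  rintro _ ⟨⟨f, hf⟩, rfl⟩
  rw [SetLike.mem_coe, LinearMap.mem_ker, LinearMap.baseChange_tmul, KaehlerDifferential.map_D,
    Ideal.Quotient.algebraMap_eq, Ideal.Quotient.eq_zero_iff_mem.mpr hf, map_zero,
    TensorProduct.tmul_zero]

/-! ### The retraction: descending `s ↦ [1 ⊗ ds]` to `S/J` -/

/-- The derivation `s ↦ [1 ⊗ ds]` of `S` into `(L ⊗_S Ω[S⁄R]) ⧸ conormalSpan`. [folklore] -/
def quotientMkDerivation :
    Derivation R S ((L ⊗[S] Ω[S⁄R]) ⧸ conormalSpan R S J L) :=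
  (((conormalSpan R S J L).mkQ.restrictScalars S) ∘ₗ
    ((TensorProduct.mk S L Ω[S⁄R] 1).restrictScalars S)).compDer (D R S)

omit [Algebra (S ⧸ J) L] [IsScalarTower S (S ⧸ J) L] [IsScalarTower R (S ⧸ J) L] in
/-- `quotientMkDerivation s = [1 ⊗ ds]`. [folklore] -/
@[simp]
theorem quotientMkDerivation_apply (s : S) :
    quotientMkDerivation R S J L s = (conormalSpan R S J L).mkQ ((1 : L) ⊗ₜ[S] D R S s) :=
  rfl

omit [Algebra (S ⧸ J) L] [IsScalarTower S (S ⧸ J) L] [IsScalarTower R (S ⧸ J) L] in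
/-- The derivation `s ↦ [1 ⊗ ds]` kills `J`. [folklore] -/
theorem quotientMkDerivation_eq_zero {f : S} (hf : f ∈ J) :
    quotientMkDerivation R S J L f = 0 := by
  rw [quotientMkDerivation_apply, mkQ_apply, Quotient.mk_eq_zero]
  exact tmul_D_mem_conormalSpan R S J L hf

/-- **The descended derivation** `S/J → (L ⊗_S Ω[S⁄R]) ⧸ conormalSpan`, `s̄ ↦ [1 ⊗ ds]`
(well defined: the derivation kills `J`; a derivation: `J` acts trivially on the target, an
`L`-module). [folklore] -/
def quotientDerivation :
    Derivation R (S ⧸ J) ((L ⊗[S] Ω[S⁄R]) ⧸ conormalSpan R S J L) where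
  toLinearMap :=
    ((J.restrictScalars R).liftQ (quotientMkDerivation R S J L).toLinearMap (by
      intro f hf
      exact quotientMkDerivation_eq_zero R S J L hf)) ∘ₗ
      (Submodule.Quotient.restrictScalarsEquiv R (J : Submodule S S)).symm.toLinearMap
  map_one_eq_zero' := by
    show quotientMkDerivation R S J L 1 = 0
    exact (quotientMkDerivation R S J L).map_one_eq_zero
  leibniz' := by
    intro x y
    obtain ⟨s, rfl⟩ := Ideal.Quotient.mk_surjective x
    obtain ⟨t, rfl⟩ := Ideal.Quotient.mk_surjective y
    rw [← map_mul]
    show quotientMkDerivation R S J L (s * t) =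
      Ideal.Quotient.mk J s • quotientMkDerivation R S J L t +
        Ideal.Quotient.mk J t • quotientMkDerivation R S J L s
    rw [Derivation.leibniz, ← Ideal.Quotient.algebraMap_eq, algebraMap_smul, algebraMap_smul]

omit [IsScalarTower R (S ⧸ J) L] in
/-- `quotientDerivation s̄ = [1 ⊗ ds]`. [folklore] -/
@[simp]
theorem quotientDerivation_mk (s : S) :
    quotientDerivation R S J L (Ideal.Quotient.mk J s) =
      (conormalSpan R S J L).mkQ ((1 : L) ⊗ₜ[S] D R S s) :=
  rfl

/-- **The retraction** `L ⊗_{S/J} Ω[(S/J)⁄R] → (L ⊗_S Ω[S⁄R]) ⧸ conormalSpan`,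
`l ⊗ d s̄ ↦ [l ⊗ ds]`. [folklore] -/
def quotientRetraction :
    L ⊗[S ⧸ J] Ω[(S ⧸ J)⁄R] →ₗ[L] (L ⊗[S] Ω[S⁄R]) ⧸ conormalSpan R S J L :=
  LinearMap.liftBaseChange L (quotientDerivation R S J L).liftKaehlerDifferential

/-- `quotientRetraction (l ⊗ d s̄) = [l ⊗ ds]`. [folklore] -/
theorem quotientRetraction_tmul_D (l : L) (s : S) :
    quotientRetraction R S J L (l ⊗ₜ[S ⧸ J] D R (S ⧸ J) (Ideal.Quotient.mk J s)) =
      (conormalSpan R S J L).mkQ (l ⊗ₜ[S] D R S s) := by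
  rw [quotientRetraction, LinearMap.liftBaseChange_tmul, Derivation.liftKaehlerDifferential_comp_D,
    quotientDerivation_mk, ← map_smul, TensorProduct.smul_tmul', smul_eq_mul, mul_one]

/-- The retraction splits the natural map: `quotientRetraction ∘ (L ⊗_S Ω[S⁄R] → L ⊗ Ω[(S/J)⁄R])`
is the quotient map. [folklore] -/
theorem quotientRetraction_comp :
    quotientRetraction R S J L ∘ₗ (tensorQuotientEquiv J L Ω[(S ⧸ J)⁄R]).toLinearMap ∘ₗ
        (KaehlerDifferential.map R R S (S ⧸ J)).baseChange L =
      (conormalSpan R S J L).mkQ := by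
  refine TensorProduct.AlgebraTensorModule.ext fun l ω => ?_
  simp only [LinearMap.comp_apply, LinearEquiv.coe_coe, LinearMap.baseChange_tmul,
    tensorQuotientEquiv_tmul]
  -- reduce to `ω = ds`
  have key : ∀ ω : Ω[S⁄R],
      quotientRetraction R S J L (l ⊗ₜ[S ⧸ J] KaehlerDifferential.map R R S (S ⧸ J) ω) =
        (conormalSpan R S J L).mkQ (l ⊗ₜ[S] ω) := by
    intro ω
    have hω : ω ∈ span S (Set.range (D R S)) := by
      rw [KaehlerDifferential.span_range_derivation]; trivial
    induction hω using span_induction with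
    | mem _ h =>
      obtain ⟨s, rfl⟩ := h
      rw [KaehlerDifferential.map_D, Ideal.Quotient.algebraMap_eq]
      exact quotientRetraction_tmul_D R S J L l s
    | zero => simp
    | add ω₁ ω₂ _ _ h₁ h₂ => rw [map_add, TensorProduct.tmul_add, map_add, h₁, h₂,
        TensorProduct.tmul_add, map_add]
    | smul s ω _ h =>
      have e1 : l ⊗ₜ[S ⧸ J] (s • KaehlerDifferential.map R R S (S ⧸ J) ω) =
          s • (l ⊗ₜ[S ⧸ J] KaehlerDifferential.map R R S (S ⧸ J) ω) := by
        rw [TensorProduct.smul_tmul', TensorProduct.smul_tmul]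
      have e2 : l ⊗ₜ[S] (s • ω) = s • (l ⊗ₜ[S] ω) := by
        rw [TensorProduct.smul_tmul', TensorProduct.smul_tmul]
      rw [map_smul, e1, LinearMap.map_smul_of_tower, h, e2, LinearMap.map_smul_of_tower]
  exact key ω

/-- **The kernel of `L ⊗_S Ω[S⁄R] → L ⊗_S Ω[(S/J)⁄R]` is the conormal span** (the conormal
sequence of `S → S/J`, base-changed to `L`). [folklore] -/
theorem ker_map_baseChange_eq_conormalSpan :
    LinearMap.ker ((KaehlerDifferential.map R R S (S ⧸ J)).baseChange L) = conormalSpan R S J L := by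
  refine le_antisymm ?_ (conormalSpan_le_ker R S J L)
  intro x hx
  have h := LinearMap.congr_fun (quotientRetraction_comp R S J L) x
  simp only [LinearMap.comp_apply, LinearMap.mem_ker.mp hx, map_zero] at h
  rw [mkQ_apply, eq_comm, Quotient.mk_eq_zero] at h
  exact h

/-- **`(L ⊗_S Ω[S⁄R]) ⧸ conormalSpan ≃ L ⊗_{S/J} Ω[(S/J)⁄R]`.** [folklore] -/
def quotientConormalSpanEquiv :
    ((L ⊗[S] Ω[S⁄R]) ⧸ conormalSpan R S J L) ≃ₗ[L] L ⊗[S ⧸ J] Ω[(S ⧸ J)⁄R] :=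
  (quotEquivOfEq _ _ (ker_map_baseChange_eq_conormalSpan R S J L).symm) ≪≫ₗ
    (LinearMap.quotKerEquivOfSurjective _ (map_baseChange_surjective R S J L)) ≪≫ₗ
      tensorQuotientEquiv J L Ω[(S ⧸ J)⁄R]

/-- `quotientConormalSpanEquiv [l ⊗ ds] = l ⊗ d s̄`. [folklore] -/
@[simp]
theorem quotientConormalSpanEquiv_mk (l : L) (s : S) :
    quotientConormalSpanEquiv R S J L ((conormalSpan R S J L).mkQ (l ⊗ₜ[S] D R S s)) =
      l ⊗ₜ[S ⧸ J] D R (S ⧸ J) (Ideal.Quotient.mk J s) := by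
  simp [quotientConormalSpanEquiv, LinearMap.quotKerEquivOfSurjective, KaehlerDifferential.map_D]

/-- **Néron's `δ` through the conormal span**: for the `L`-valued point of `X = Spec S/J` given
by the `S/J`-algebra `L`,
`δ = length (torsion ((L ⊗_S Ω[S⁄R]) ⧸ conormalSpan))`. [folklore] -/
theorem neronDefect_quotient_eq :
    neronDefect R (S ⧸ J) L =
      Module.length L (torsion L ((L ⊗[S] Ω[S⁄R]) ⧸ conormalSpan R S J L)) :=
  (length_torsion_eq (quotientConormalSpanEquiv R S J L)).symm

/-- **Ranks**: `rank conormalSpan + rank (L ⊗_{S/J} Ω[(S/J)⁄R]) = rank (L ⊗_S Ω[S⁄R])` for a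
domain `L` and `Ω[S⁄R]` finite over `S` (e.g. `S` a polynomial ring: then the right-hand side is
the number of variables). [folklore] -/
theorem finrank_conormalSpan_add [IsDomain L] [Module.Finite S Ω[S⁄R]] :
    Module.finrank L (conormalSpan R S J L) + Module.finrank L (L ⊗[S ⧸ J] Ω[(S ⧸ J)⁄R]) =
      Module.finrank L (L ⊗[S] Ω[S⁄R]) := by
  rw [← (quotientConormalSpanEquiv R S J L).finrank_eq, add_comm]
  exact Submodule.finrank_quotient_add_finrank _

end Literature.AlgebraicGeometry.Smoothening
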